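import Literature.ModelTheory.ExponentialFields.OMinimalC1Real
import Literature.ModelTheory.ExponentialFields.OMinimalDimensionInvariance
import HarnessLib

/-!
# Definable functions are `C¹` off a closed definable set of smaller dimension (van den Dries, Ch. 7, §3)

Topic `Literature/ModelTheory/ExponentialFields`.  A packaging of the `C¹`-cell
decomposition theorem of L. van den Dries, *Tame topology and o-minimal structures* (1998),
Ch. 7, (3.2) (`OMinimalC1CellDecomposition.lean`; §3 is titled "Definable maps are piecewise
`C¹`") in the form in which it is typically consumed: for a definable `f : Mᵐ → M` in an
o-minimal expansion of an ordered field, take a decomposition `𝒟` of `Mᵐ` into `C¹`-cells with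
`f` `C¹` on each cell; the union `O` of the open cells of `𝒟` is open and `f` has `C¹` partials
on it (the partials being local, they agree on an open cell with those of the `C¹` extension
given by (3.1)), while its complement `Z`, the union of the non-open cells, is closed,
definable, has empty interior and — by Ch. 4, (1.3)–(1.4) (`dim_biUnion`, `dim_eq_typeDim`) —
dimension `< m`:

* `exists_isClosed_dim_lt_hasC1PartialsOn_compl` — general o-minimal expansions of ordered
  fields (`HasC1PartialsOn f Zᶜ`);
* `real_exists_isClosed_dim_lt_contDiffOn_compl` — over the real field, with Mathlib's
  `ContDiffOn ℝ 1 f Zᶜ` (`OMinimalC1Real.lean`).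

Nothing here is a named fact; no definition is introduced.

## References

* [Dries1998] L. van den Dries, *Tame topology and o-minimal structures*, London Math. Soc.
  Lecture Note Ser. 248, CUP 1998, Ch. 7, §3, (3.2), pp. 115–116; Ch. 4, (1.3)–(1.4).
-/

open Set FirstOrder FirstOrder.Language Function
open _root_.Filter _root_.Topology

namespace Literature.ModelTheory.ExponentialFields

open CellDimension

section OMinimal

variable {L : FirstOrder.Language.{0, 0}} {M : Type*} [L.Structure M] [Field M] [LinearOrder M]
  [IsStrictOrderedRing M] (φ : Language.orderedRing →ᴸ L) [φ.IsExpansionOn M]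
  [TopologicalSpace M] [OrderTopology M]

omit [LinearOrder M] [IsStrictOrderedRing M] [OrderTopology M] in
/-- Partial derivatives are local: if `f = F` on an open set `C ∋ y`, the partials of `f` and
`F` at `y` agree. [folklore] -/
theorem hasPartialDerivAt_congr_of_eqOn_isOpen [IsTopologicalRing M] {m : ℕ}
    {f F : (Fin m → M) → M} {C : Set (Fin m → M)} (hC : IsOpen C) (hfF : EqOn F f C)
    {y : Fin m → M} (hy : y ∈ C) {i : Fin m} {d : M} (h : HasPartialDerivAt F i d y) :
    HasPartialDerivAt f i d y := by
  rw [hasPartialDerivAt_iff] at h ⊢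
  refine h.congr_of_eventuallyEq ?_
  -- `t ↦ update y i t` is continuous and maps `y i` into `C`
  have hcont : Continuous fun t : M => update y i t := by
    refine continuous_pi fun j => ?_
    by_cases hj : j = i
    · subst hj
      simp only [update_self]
      exact continuous_id
    · simpa [update_of_ne hj] using continuous_const
  have hmem : ∀ᶠ t in 𝓝 (y i), update y i t ∈ C := by
    have h0 : update y i (y i) ∈ C := by simpa using hy
    exact hcont.continuousAt.preimage_mem_nhds (hC.mem_nhds h0)
  filter_upwards [hmem] with t ht
  exact hfF ht

include φ

/-- **Definable functions are `C¹` off a closed definable set of smaller dimension**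
(van den Dries 1998, Ch. 7, §3, from (3.2)): for a definable `f : Mᵐ → M` in an o-minimal
expansion of an ordered field there is a closed definable `Z ⊆ Mᵐ` with empty interior and
`dim Z < m` (when `m > 0`) such that `f` has `C¹` partials on the open set `Mᵐ ∖ Z` — `Z` is
the union of the non-open cells of a `C¹`-cell decomposition adapted to `f`.
[cite: Dries1998, Ch. 7 (3.2)] -/
theorem exists_isClosed_dim_lt_hasC1PartialsOn_compl (hO : L.IsOMinimal M) {m : ℕ}
    (f : (Fin m → M) → M) (hf : (univ : Set M).DefinableFun L f) :
    ∃ Z : Set (Fin m → M), IsClosed Z ∧ (univ : Set M).Definable L Z ∧ interior Z = ∅ ∧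
      (0 < m → dim L m Z < m) ∧ HasC1PartialsOn f Zᶜ := by
  classical
  have hlt : (univ : Set M).Definable L {v : Fin 2 → M | v 0 < v 1} :=
    OrderedFieldExpansion.definable_lt φ univ
  obtain ⟨𝒟, h𝒟, hc1⟩ := exists_isC1Decomposition_isDefinableC1On φ hO f hf
  -- the open and the non-open cells
  set 𝒪 : Finset (Set (Fin m → M)) := 𝒟.filter fun C => IsCell L m (fun _ => true) C with h𝒪
  set 𝒩 : Finset (Set (Fin m → M)) := 𝒟.filter fun C => ¬ IsCell L m (fun _ => true) C with h𝒩
  set O : Set (Fin m → M) := ⋃ C ∈ 𝒪, C with hOdef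
  set Z : Set (Fin m → M) := ⋃ C ∈ 𝒩, C with hZdef
  have hOopen : IsOpen O := isOpen_biUnion fun C hC => (Finset.mem_filter.1 hC).2.isOpen
  have hZO : Z = Oᶜ := by
    ext x
    simp only [hZdef, hOdef, mem_iUnion, mem_compl_iff, not_exists]
    constructor
    · rintro ⟨C, hC, hxC⟩ C' hC' hxC'
      have hne : C ≠ C' := fun h => (Finset.mem_filter.1 hC).2 (h ▸ (Finset.mem_filter.1 hC').2)
      exact Set.disjoint_left.1 (h𝒟.1.disjoint C (Finset.mem_filter.1 hC).1 C'
        (Finset.mem_filter.1 hC').1 hne) hxC hxC'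
    · intro hx
      obtain ⟨C, hC, hxC⟩ := h𝒟.1.exists_mem x
      by_cases hCo : IsCell L m (fun _ => true) C
      · exact (hx C (Finset.mem_filter.2 ⟨hC, hCo⟩) hxC).elim
      · exact ⟨C, Finset.mem_filter.2 ⟨hC, hCo⟩, hxC⟩
  have hcompl : Zᶜ = O := by rw [hZO, compl_compl]
  have hZdefn : (univ : Set M).Definable L Z := by
    refine definable_biUnion_of_forall_mem 𝒩 fun C hC => ?_
    obtain ⟨ι, hι⟩ := h𝒟.1.isCell C (Finset.mem_filter.1 hC).1
    exact hι.definable hlt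
  -- dimension of `Z`
  have hdim : 0 < m → dim L m Z < m := by
    intro hm
    rw [hZdef, dim_biUnion hO hlt 𝒩 fun C hC => by
      obtain ⟨ι, hι⟩ := h𝒟.1.isCell C (Finset.mem_filter.1 hC).1
      exact hι.definable hlt]
    refine (Finset.sup_lt_iff (bot_lt_iff_ne_bot.2 (Nat.pos_iff_ne_zero.1 hm))).2 fun C hC => ?_
    obtain ⟨hC𝒟, hCo⟩ := Finset.mem_filter.1 hC
    obtain ⟨ι, hι⟩ := h𝒟.1.isCell C hC𝒟
    have hιo : ι ≠ fun _ => true := fun h => hCo (h ▸ hι)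
    rw [dim_eq_typeDim hO hlt hι]
    exact card_filter_lt_of_ne hιo
  -- empty interior
  have hint : interior Z = ∅ := by
    rcases Nat.eq_zero_or_pos m with hm | hm
    · -- in `M⁰` every cell is open, so `Z = ∅`
      subst hm
      have hZ : Z = ∅ := by
        rw [hZdef]
        refine Set.eq_empty_of_forall_notMem fun x hx => ?_
        obtain ⟨C, hC, -⟩ := mem_iUnion₂.1 hx
        obtain ⟨hC𝒟, hCo⟩ := Finset.mem_filter.1 hC
        obtain ⟨ι, hι⟩ := h𝒟.1.isCell C hC𝒟
        exact hCo (by rwa [show (fun _ : Fin 0 => true) = ι from funext fun i => i.elim0])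
      rw [hZ, interior_empty]
    · by_contra hne
      have h := dim_eq_of_interior_nonempty (L := L) hlt (nonempty_iff_ne_empty.2 hne)
      exact absurd h (hdim hm).ne
  refine ⟨Z, by rw [hZO]; exact hOopen.isClosed_compl, hZdefn, hint, hdim, ?_⟩
  -- `C¹` partials on `O`
  rw [hcompl]
  have hg : ∀ i : Fin m, ∃ g : (Fin m → M) → M, (univ : Set M).DefinableFun L g ∧
      ∀ x d, HasPartialDerivAt f i d x → g x = d := fun i => exists_definableFun_partial φ hf i
  choose g _ hgspec using hg
  -- on each open cell, the partials of `f` exist, are given by `g`, and `g` is continuous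
  have hcellO : ∀ C ∈ 𝒪, ∀ i, (∀ y ∈ C, HasPartialDerivAt f i (g i y) y) ∧ ContinuousOn (g i) C := by
    intro C hC i
    obtain ⟨hC𝒟, hCo⟩ := Finset.mem_filter.1 hC
    have hCopen : IsOpen C := hCo.isOpen
    obtain ⟨U, hU, -, hCU, F, -, hF, hFf⟩ := hc1 C hC𝒟
    obtain ⟨gF, hgF, hgFc⟩ := hF i
    have hpart : ∀ y ∈ C, HasPartialDerivAt f i (gF y) y := fun y hy =>
      hasPartialDerivAt_congr_of_eqOn_isOpen hCopen hFf hy (hgF y (hCU hy))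
    have heq : EqOn (g i) gF C := fun y hy => hgspec i y (gF y) (hpart y hy)
    refine ⟨fun y hy => ?_, ((hgFc.mono hCU).congr heq)⟩
    rw [heq hy]
    exact hpart y hy
  intro i
  refine ⟨g i, fun x hx => ?_, fun x hx => ?_⟩
  · obtain ⟨C, hC, hxC⟩ := mem_iUnion₂.1 hx
    exact (hcellO C hC i).1 x hxC
  · obtain ⟨C, hC, hxC⟩ := mem_iUnion₂.1 hx
    have hCopen : IsOpen C := (Finset.mem_filter.1 hC).2.isOpen
    exact ((hcellO C hC i).2.continuousAt (hCopen.mem_nhds hxC)).continuousWithinAt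

end OMinimal

/-! ### Over `ℝ` -/

/-- **Definable real functions are `C¹` off a closed definable set of smaller dimension**
(van den Dries 1998, Ch. 7, §3, from (3.2), for an o-minimal expansion of the real field, with
Mathlib's `ContDiffOn ℝ 1`): for a definable `f : ℝᵐ → ℝ` there is a closed definable `Z`
with empty interior and `dim Z < m` (when `m > 0`) such that `f` is `C¹` on `ℝᵐ ∖ Z`.
[cite: Dries1998, Ch. 7 (3.2)] -/
theorem real_exists_isClosed_dim_lt_contDiffOn_compl {L : FirstOrder.Language.{0, 0}}
    [L.Structure ℝ] (φ : Language.orderedRing →ᴸ L) [φ.IsExpansionOn ℝ] (hO : L.IsOMinimal ℝ)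
    {m : ℕ} (f : (Fin m → ℝ) → ℝ) (hf : (univ : Set ℝ).DefinableFun L f) :
    ∃ Z : Set (Fin m → ℝ), IsClosed Z ∧ (univ : Set ℝ).Definable L Z ∧ interior Z = ∅ ∧
      (0 < m → dim L m Z < m) ∧ ContDiffOn ℝ 1 f Zᶜ := by
  obtain ⟨Z, hZc, hZd, hint, hdim, hC1⟩ := exists_isClosed_dim_lt_hasC1PartialsOn_compl φ hO f hf
  exact ⟨Z, hZc, hZd, hint, hdim, hC1.contDiffOn_real φ hO hf hZc.isOpen_compl⟩

end Literature.ModelTheory.ExponentialFields
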